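import Literature.AnabelianGeometry.SemiGraphs.SubgroupPresentationStabilizers
import Literature.AnabelianGeometry.SemiGraphs.SubgroupPresentationArithAction
import Literature.AnabelianGeometry.SemiGraphs.TemperedMaximalCompact
import Literature.AnabelianGeometry.SemiGraphs.TemperedReconstructionReductionsProofs
import HarnessLib

/-!
# [SemiAnbd] Thm 5.4 packaging glue: the TWO-SIDED dictionary binders (I1)–(I3) of
# `ArithLevelDataCpt.ofChartEdgeData` for the ARITHMETIC action on a coset-graph tower, from
# abc-iut-w4-d059's deck-action dictionaries («T54-B-dict2»)

Mochizuki, *Semi-graphs of anabelioids*, Publ. RIMS **42** (2006), proof of Thm 3.7 (iii) p. 41 (with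
the author's Comments (6)) and §5 p. 65 / Thm 5.4 (i) p. 66. [cite: MochizukiSemiAnbd2006, Thm 5.4 (i), p. 66]

PROOF-ONLY glue (abc-iut-w4-d053, package owner / T54-B packager; GAP-LEDGER G-w4d053-1).  The producer
constructor `ArithLevelDataCpt.ofChartEdgeData` (ArithLevelDataCptOfChart.lean) takes the two-sided
geometric dictionaries in the shape "for `H ∈ verticialSubgroups c v` … `n ∈ H ↔ ∀ j, act j (ι n)` fixes
`x j`" (`hfixN`, `hstabN`, `hedgeN`, `hedgeFixN`).  abc-iut-w4-d059's SubgroupPresentationStabilizers.lean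
(p421707, «T54-B-dict2») proves them for the DECK action of `Γ = π₁^temp(𝒢)` on abc-iut-L3-d4's coset
graphs `P.cosetGraph (K j)`, phrased with the conjugates `y⁻¹ H_w y` / `y⁻¹ M_e y` of the presentation's
vertex / edge groups.  Here the two currencies are identified:

* the presentation's groups are §3 verticial / edge-like representatives (`hPH : P.H w ∈ verticialSubgroups
  c w`, `hPM : P.M e ∈ edgeLikeSubgroups c e` — true for abc-iut-L3-d4's `piPresentation`, whose `H_w` is
  the range of a verticial homomorphism), and verticial (edge-like) subgroups at one vertex (edge) form ONE
  conjugacy class (`exists_conj_of_mem_verticialSubgroups`, `conj_mem_verticialSubgroups`, Prop 3.2);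
* the arithmetic action restricted along `ι` IS the deck action
  (`SubgroupPresentation.arithAct_eq_deckAct_of_inner`, abc-iut-L3-d4 T1c).

RESULT: `hfixN_of_cosetTower`, `hstabN_of_cosetTower`, `hedgeN_of_cosetTower`, `hedgeFixN_of_cosetTower`
— the four binders of `ArithLevelDataCpt.ofChartEdgeData` at `tree j := P.cosetGraph (K j)`,
`act j := P.arithAct hP (K j) _`, `trans h := P.cosetGraphTrans (hK h)` — from dict2's algebraic tower
inputs `hHK`/`hMK` (`⋂ H_w K_j = H_w`) and `hlift`/`hliftE` (compatible double-coset systems lift; their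
topological discharge is abc-iut-w4-d085's (P-K)), trees at every level (`hT`) and a base GRAPH (`hG`).
Nothing here asserts a statement of the paper beyond what is proved; typed ≠ proved; no side taken on
[IUTchIII] Cor 3.12.
-/

namespace Literature.AnabelianGeometry.SemiGraphs

namespace ProfiniteSemiGraph

open CategoryTheory
open scoped Pointwise

universe u v w

variable {𝒢 : ProfiniteSemiGraph.{u}} (c : TemperedPiChart 𝒢) {E : Type w} [Group E]
  (P : SemiGraph.SubgroupPresentation 𝒢.graph c.G) {Φ : E →* MulAut c.G} {σ : E →* Aut 𝒢.graph}
  (hP : P.IsArithCompatible Φ σ) (ι : c.G →* E)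
  (hιΦ : ∀ g : c.G, Φ (ι g) = MulAut.conj g) (hισ : ∀ g : c.G, σ (ι g) = 1)
  {J : Type v} [Preorder J] [IsDirectedOrder J] [Nonempty J]
  (K : J → Subgroup c.G) [∀ j, (K j).Normal] (hK : ∀ ⦃i j : J⦄, i ≤ j → K j ≤ K i)
  (hKst : ∀ (j : J) (e : E) (x : c.G), x ∈ K j → Φ e x ∈ K j)

/-- `y⁻¹ H y` as `Subgroup.map`: the conjugate by `y⁻¹`. [cite: MochizukiSemiAnbd2006, Thm 3.7(i) p.40] -/
private theorem map_conj_inv_mem_verticialSubgroups {v : 𝒢.graph.Vertex} {H : Subgroup c.G}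
    (hH : H ∈ verticialSubgroups c v) (y : c.G) :
    H.map (MulAut.conj y⁻¹).toMonoidHom ∈ verticialSubgroups c v :=
  conj_mem_verticialSubgroups c hH y⁻¹

omit [Preorder J] [IsDirectedOrder J] [Nonempty J] in
include hιΦ hισ in
/-- The arithmetic action along `ι` fixes a vertex iff the deck action does.
[cite: MochizukiSemiAnbd2006, Thm 5.4, p. 66] -/
private theorem arithAct_inner_vertexMap (j : J) (n : c.G) (x : (P.cosetGraph (K j)).Vertex) :
    (P.arithAct hP (K j) (hKst j) (ι n)).hom.vertexMap x = (P.deckAct (K j) n).hom.vertexMap x := by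
  rw [P.arithAct_eq_deckAct_of_inner hP (K j) (hKst j) (hιΦ n) (hισ n)]

include hιΦ hισ in
/-- **(I1) two-sided for the arithmetic action along `ι`** (`hfixN` of `ArithLevelDataCpt.ofChartEdgeData`):
every §3 verticial subgroup `H` at `v` is the full stabiliser of a compatible vertex system of the coset
trees — `H = y⁻¹ H_v y` (one conjugacy class) and the system `(H_v y K_j)_j` (abc-iut-w4-d059's
`stabilizer_vMk_system`). [cite: MochizukiSemiAnbd2006, Thm 5.4 (i), p. 66] -/
theorem hfixN_of_cosetTower (hPH : ∀ w, P.H w ∈ verticialSubgroups c w)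
    (hHK : ∀ (w : 𝒢.graph.Vertex) (x : c.G), (∀ j, x ∈ (P.H w : Set c.G) * (K j : Set c.G)) → x ∈ P.H w)
    (v : 𝒢.graph.Vertex) (H : Subgroup c.G) (hH : H ∈ verticialSubgroups c v) :
    ∃ x : ∀ j, (P.cosetGraph (K j)).Vertex,
      (∀ ⦃i j : J⦄ (h : i ≤ j), (P.cosetGraphTrans (hK h)).vertexMap (x j) = x i) ∧
        ∀ n : c.G, n ∈ H ↔ ∀ j, (P.arithAct hP (K j) (hKst j) (ι n)).hom.vertexMap (x j) = x j := by
  obtain ⟨g, rfl⟩ := exists_conj_of_mem_verticialSubgroups c (hPH v) hH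
  obtain ⟨hcompat, hstab⟩ := P.stabilizer_vMk_system K hK hHK v g⁻¹
  refine ⟨fun j => P.vMk (K j) v g⁻¹, hcompat, fun n => ?_⟩
  simp only [arithAct_inner_vertexMap c P hP ι hιΦ hισ K hKst]
  rw [hstab n, inv_inv]

include hιΦ hισ in
/-- **(I2) two-sided for the arithmetic action along `ι`** (`hstabN`): the full stabiliser of any
compatible vertex system of the coset trees is a §3 verticial subgroup (abc-iut-w4-d059's
`exists_rep_and_stabilizer_of_compatible`: the system is `(H_w y K_j)_j` for one `y`, stabiliser
`y⁻¹ H_w y`). [cite: MochizukiSemiAnbd2006, Thm 5.4 (i), p. 66] -/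
theorem hstabN_of_cosetTower (hPH : ∀ w, P.H w ∈ verticialSubgroups c w)
    (hHK : ∀ (w : 𝒢.graph.Vertex) (x : c.G), (∀ j, x ∈ (P.H w : Set c.G) * (K j : Set c.G)) → x ∈ P.H w)
    (hlift : ∀ (w : 𝒢.graph.Vertex) (y : J → c.G),
      (∀ ⦃i j : J⦄, i ≤ j →
        DoubleCoset.mk (P.H w) (K i) (y j) = DoubleCoset.mk (P.H w) (K i) (y i)) →
      ∃ z : c.G, ∀ j, DoubleCoset.mk (P.H w) (K j) z = DoubleCoset.mk (P.H w) (K j) (y j))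
    (x : ∀ j, (P.cosetGraph (K j)).Vertex)
    (hx : ∀ ⦃i j : J⦄ (h : i ≤ j), (P.cosetGraphTrans (hK h)).vertexMap (x j) = x i) :
    ∃ (v : 𝒢.graph.Vertex) (H : Subgroup c.G), H ∈ verticialSubgroups c v ∧
      ∀ n : c.G, n ∈ H ↔ ∀ j, (P.arithAct hP (K j) (hKst j) (ι n)).hom.vertexMap (x j) = x j := by
  obtain ⟨w, y, -, hstab⟩ := P.exists_rep_and_stabilizer_of_compatible K hK hHK hlift x hx
  refine ⟨w, (P.H w).map (MulAut.conj y⁻¹).toMonoidHom,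
    map_conj_inv_mem_verticialSubgroups c (hPH w) y, fun n => ?_⟩
  simp only [arithAct_inner_vertexMap c P hP ι hιΦ hισ K hKst]
  exact (hstab n).symm

omit [Nonempty J] in
include hιΦ hισ in
/-- **(I3) two-sided for the arithmetic action along `ι`** (`hedgeN`): the full stabiliser (edges with
their branches) of an eventual compatible edge system of the coset trees is a §3 edge-like subgroup
(abc-iut-w4-d059's `exists_rep_of_compatible_edges` + `stabilizer_eMk_system`).
[cite: MochizukiSemiAnbd2006, Thm 5.4 (i), p. 66] -/
theorem hedgeN_of_cosetTower (hPM : ∀ e, P.M e ∈ edgeLikeSubgroups c e)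
    (hMK : ∀ (e : 𝒢.graph.Edge) (x : c.G), (∀ j, x ∈ (P.M e : Set c.G) * (K j : Set c.G)) → x ∈ P.M e)
    (hliftE : ∀ (j₁ : J) (e : 𝒢.graph.Edge) (y : {j : J // j₁ ≤ j} → c.G),
      (∀ ⦃i j : {j : J // j₁ ≤ j}⦄, i.1 ≤ j.1 →
        DoubleCoset.mk (P.M e) (K i.1) (y j) = DoubleCoset.mk (P.M e) (K i.1) (y i)) →
      ∃ z : c.G, ∀ j, DoubleCoset.mk (P.M e) (K j.1) z = DoubleCoset.mk (P.M e) (K j.1) (y j))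
    (j₁ : J) (ε : ∀ j : {j : J // j₁ ≤ j}, (P.cosetGraph (K j.1)).Edge)
    (hε : ∀ ⦃i j : {j : J // j₁ ≤ j}⦄ (h : i.1 ≤ j.1), (P.cosetGraphTrans (hK h)).edgeMap (ε j) = ε i) :
    ∃ (e : 𝒢.graph.Edge) (L : Subgroup c.G), L ∈ edgeLikeSubgroups c e ∧
      ∀ n : c.G, n ∈ L ↔ ∀ j, (P.arithAct hP (K j.1) (hKst j.1) (ι n)).hom.edgeMap (ε j) = ε j ∧
        ∀ b : (P.cosetGraph (K j.1)).Branch, (P.cosetGraph (K j.1)).edgeOf b = ε j →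
          (P.arithAct hP (K j.1) (hKst j.1) (ι n)).hom.branchMap b = b := by
  obtain ⟨e, y, hεy⟩ := P.exists_rep_of_compatible_edges K hK j₁ (hliftE j₁) ε hε
  obtain ⟨-, hstab⟩ := P.stabilizer_eMk_system K hK hMK e y j₁
  refine ⟨e, (P.M e).map (MulAut.conj y⁻¹).toMonoidHom, conj_mem_edgeLikeSubgroups' c (hPM e) y⁻¹,
    fun n => ?_⟩
  rw [← hstab n]
  refine forall_congr' fun j => ?_
  rw [hεy j, P.arithAct_eq_deckAct_of_inner hP (K j.1) (hKst j.1) (hιΦ n) (hισ n)]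

include hιΦ hισ in
/-- **(I3) converse with end data for the arithmetic action along `ι`** (`hedgeFixN`): every §3
edge-like subgroup `L` at `e` is the full stabiliser of an eventual compatible edge system of the coset
trees, given with its branch systems and its two compatible, level-wise distinct end-vertex systems — `L =
y⁻¹ M_e y` (one conjugacy class), the system `(M_e y K_j)_j` with ends `H_{w_i} s_{b_i} y K_j`
(abc-iut-w4-d059's `stabilizer_eMk_system` + `ends_eMk_system`; the coset graphs are trees, the base is a
graph). [cite: MochizukiSemiAnbd2006, Thm 5.4 (i), p. 66] -/
theorem hedgeFixN_of_cosetTower (hPM : ∀ e, P.M e ∈ edgeLikeSubgroups c e)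
    (hMK : ∀ (e : 𝒢.graph.Edge) (x : c.G), (∀ j, x ∈ (P.M e : Set c.G) * (K j : Set c.G)) → x ∈ P.M e)
    (hT : ∀ j, (P.cosetGraph (K j)).IsTree) (hG : 𝒢.graph.IsGraph)
    (e : 𝒢.graph.Edge) (L : Subgroup c.G) (hL : L ∈ edgeLikeSubgroups c e) :
    ∃ (j₁ : J) (ε : ∀ j : {j : J // j₁ ≤ j}, (P.cosetGraph (K j.1)).Edge)
      (c₁ c₂ : ∀ j : {j : J // j₁ ≤ j}, (P.cosetGraph (K j.1)).Branch)
      (x₁ x₂ : ∀ j, (P.cosetGraph (K j)).Vertex),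
      (∀ ⦃i j : J⦄ (h : i ≤ j), (P.cosetGraphTrans (hK h)).vertexMap (x₁ j) = x₁ i) ∧
      (∀ ⦃i j : J⦄ (h : i ≤ j), (P.cosetGraphTrans (hK h)).vertexMap (x₂ j) = x₂ i) ∧
      (∀ j, x₁ j.1 ≠ x₂ j.1 ∧ (P.cosetGraph (K j.1)).edgeOf (c₁ j) = ε j ∧
        (P.cosetGraph (K j.1)).edgeOf (c₂ j) = ε j ∧
        (P.cosetGraph (K j.1)).abuts (c₁ j) = some (x₁ j.1) ∧
        (P.cosetGraph (K j.1)).abuts (c₂ j) = some (x₂ j.1)) ∧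
      ∀ n : c.G, n ∈ L ↔ ∀ j, (P.arithAct hP (K j.1) (hKst j.1) (ι n)).hom.edgeMap (ε j) = ε j ∧
        ∀ b : (P.cosetGraph (K j.1)).Branch, (P.cosetGraph (K j.1)).edgeOf b = ε j →
          (P.arithAct hP (K j.1) (hKst j.1) (ι n)).hom.branchMap b = b := by
  classical
  obtain ⟨j₁⟩ := ‹Nonempty J›
  -- `L = y⁻¹ M_e y`
  obtain ⟨g, rfl⟩ := exists_conj_of_mem_edgeLikeSubgroups c (hPM e) hL
  -- the two branches of `e` and their abutments
  obtain ⟨b₁, b₂, hne, hb₁, hb₂, -⟩ := 𝒢.graph.two_branches e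
  obtain ⟨w₁, hw₁⟩ := Option.isSome_iff_exists.mp (hG.abuts_isSome b₁)
  obtain ⟨w₂, hw₂⟩ := Option.isSome_iff_exists.mp (hG.abuts_isSome b₂)
  obtain ⟨hx₁, hx₂, hends⟩ := P.ends_eMk_system K hK e g⁻¹ hne hb₁ hb₂ hw₁ hw₂ hT
  obtain ⟨-, hstab⟩ := P.stabilizer_eMk_system K hK hMK e g⁻¹ j₁
  refine ⟨j₁, fun j => P.eMk (K j.1) e g⁻¹, fun j => P.bMk (K j.1) b₁ g⁻¹, fun j => P.bMk (K j.1) b₂ g⁻¹,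
    fun j => P.vMk (K j) w₁ (P.s b₁ * g⁻¹), fun j => P.vMk (K j) w₂ (P.s b₂ * g⁻¹), hx₁, hx₂,
    fun j => hends j.1, fun n => ?_⟩
  rw [show (P.M e).map (MulAut.conj g).toMonoidHom = (P.M e).map (MulAut.conj g⁻¹⁻¹).toMonoidHom by
    rw [inv_inv], ← hstab n]
  refine forall_congr' fun j => ?_
  rw [P.arithAct_eq_deckAct_of_inner hP (K j.1) (hKst j.1) (hιΦ n) (hισ n)]

end ProfiniteSemiGraph

end Literature.AnabelianGeometry.SemiGraphs
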